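import Mathlib
import HarnessLib
import HarnessLib.Audit
import Summits.NavierStokesRegularity.Statement
import Literature.Analysis.FluidPDE.ClassicalSolution
import Literature.Analysis.FluidPDE.CheskidovShvydkoyHolds
import Literature.Analysis.FluidPDE.LerayHopf
import Literature.Analysis.FluidPDE.SuitableWeak
import Literature.Analysis.FluidPDE.DissipationWavenumber
import Literature.Analysis.FunctionSpaces.LittlewoodPaleyKernel
import Summits.NavierStokesRegularity.NavierStokesRegularity.Theorems.NoBlowupToClay
import Literature.Analysis.FluidPDE.NSCriticalClosureHolds
import Literature.Analysis.FluidPDE.SelfSimilarLiouville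
import Literature.Analysis.FluidPDE.KNSSNoAxisymmetricTypeIHolds
import HarnessLib.Audit.Status.Attr

/-!
Route: RootDecompIntermittency

# Route RootDecompIntermittency — Root decomposition g3 — Clay (A) ⟺ no blow-up with a filamentary
(1-thin) Littlewood–Paley frontier ∧ no blow-up with a thick frontier — IntermittencyLadder node
(CS14 axis, rung D = 1)

ROOT DECOMPOSITION CELL decomp-ns (D-0178/D-0179, RESIDUAL MODE, blocker-first), generation 3 node
booked by route-writer decomp-ns-writer-1 (g2):
the critic-CLEARED lens-1 (g3) node IntermittencyLadder («grading / quantitative ladder», ROOT MODE;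
CRITIC-LEDGER row 35, CLEARED 2026-08-30T03:32:39Z,
no objection, tag X₁ ATTACKABLE-PARTIAL adopted; lens file
HOME/decomp-ns-lens-1/IntermittencyLadder.lean sha256
b1aae3ff0eebde0ccbe96e9157f104f3a31cc7d3097810a3ad7e19f4eea7c019, 444 lines, lean rc 0 / 0 sorry / 0
warnings, kernel `closes` (2 binders, both used),
`root_iff_pieces` (EXACT: S ⟺ X₁ ∧ X₂, excluded middle on `FrontierThin 1`),
`noBlowup_iff_rung_and_thick` (every rung D exact against its thick cell),
`noThinFrontierBlowupAt_mono` (ladder monotone in D), `ladder_arithmetic : (5−D)/2 ≤ 1+D ↔ 1 ≤ D`,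
the typed LINES `noActivelyThinBlowup_of_stubs :
CS14Criterion → ActiveThinChain → S₁` and `noThinFrontierBlowup_of_stubs : CS14Criterion →
FrontierL2Apriori → ThickBelowThinDeficit → X₁`; lens probes
HOME/decomp-ns-lens-1/bc/IntermittencyLadderProbe*.verdicts.txt 5/5 CLEAN; census data file of
record HOME/census/COSTUME-CENSUS-v2.json sha256
05830338dcd56dc85a60276b05d4c6d88311c06479f2f16e07487067c2455ac6 (+ v3 §Tests pending T-thin-1…5);
HOME = run/shared/lean/pub/decomp-ns); TREE node N8 (root-closing file
beside N2 and N5 — the lens-1 axis family: g0 sup-norm GAUGE (N2), g2 L³ RATE (N5), g3 GEOMETRY of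
the active eddies). TREE: ROOT `NavierStokesRegularity`
(Clay (A)) ⟺[EQUIV E0 + landed frame NoBlowup ⟺ S, 0055 +
`blowup_assembly`/`blowup_clay_uniqueness`] ⟸[AND, cover = excluded middle] NoThinFrontierBlowup
(X₁, crux r2, ATTACKED) ∧ NoThickFrontierBlowup (X₂, crux r3, DECLARED RESIDUAL). It suffices to
show X = X₁ ∧ X₂ with X₁ = «a classical solution on [0,T),
Leray–Hopf from its rapidly decaying datum, whose FRONTIER Littlewood–Paley shell (the top
Bernstein-saturated shell, `Λ = 2^Q` = tree
`dissipationWavenumber`) is 1-THIN at all late times — ‖Δ̇_Q u‖_∞ ≤ C·2^Q·‖Δ̇_Q u‖₂, active eddies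
tube-like or thicker, for every threshold c₀ ∈ (0,1] —
extends past T», X₂ = «the same when the frontier is NOT eventually 1-thin (sub-filamentary:
blobs/points, D < 1)». Banked beside them (aside, not in the
cone): S₁ = NoActivelyThinBlowup («every SATURATED shell 1-thin ⟹ extends», X₁ ⟹ S₁ kernel, PROVABLE
NOW from print by the typed two-stub line). Why this
is novel: no route of the census (COSTUME-CENSUS-v2.json sha256
05830338dcd56dc85a60276b05d4c6d88311c06479f2f16e07487067c2455ac6; 152 Theses grepped by the lens for
blockFn / dissipationWavenumber / intermittency / Bernstein / sparse) and no node of this cell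
splits Clay (A) by the GEOMETRY of the active Littlewood–Paley
shells: WeakLambdaEndpoint uses Λ only through a Lorentz-in-time endpoint of the D = 0 column,
SelfMixingDichotomy uses Grujić sparseness of vorticity
super-level sets, N2/N5 grade gauges and rates; here the parameter is Cheskidov–Shvydkoy's
intermittency dimension D at the frontier, the printed rung is
D > 3/2 (CS14 Thm 5.1; ARMA 2023), and the node sits at D = 1 — the rung where the a-priori exponent
1+D MEETS the criterion exponent (5−D)/2 (kernel
arithmetic), so X₁ is critical on both sides and its open content is one named lemma
(ThickBelowThinDeficit).
Lean: `NoThinFrontierBlowup ∧ NoThickFrontierBlowup`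

## Assembly
Pure logic (kernel-checked, 0 sorry): through the landed frame
`Theorems.navierStokesRegularity_of_noBlowup` it suffices that every classical Leray–Hopf
solution from a rapidly decaying datum extends past any T; by excluded middle its frontier is
eventually 1-thin (X₁ applies) or not (X₂ applies).

Rationale: WHY THIS LINE. Cheskidov–Shvydkoy 2014 (arXiv:1102.1944 [corpus:arxiv-1102.1944 p.5/7/8]) built a
unified regularity theory on the DISSIPATION WAVENUMBER Λ(t) (tree
`Literature.Analysis.FluidPDE.dissipationWavenumber`, landed with Lemma 4.1 =
`exists_lintegral_dissipationWavenumber_le`): Thm 3.1 «u regular on (0,T] iff the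
low-mode Lipschitz functional f = ‖∇u_{≤Q}‖_{B⁰_{∞,∞}} ∈ L¹(0,T)», Cor 4.3 (u ∈ L^∞B^{−r}_{∞,∞} ∧ Λ
∈ L^{1+r} ⟹ regular), Thm 5.1 (intermittency dimension D > 3/2
at the frontier, time-averaged ⟹ regular; 2023 state of the art D_{∞,2} ≥ 3/2
[corpus:arxiv-2203.11060 p.3]). The lens reads this as a LADDER in D: a D-thin
frontier gives a priori (c₀ν/C)²Λ^{1+D} ≲ ‖∇u‖₂², so Λ ∈ L^{1+D}; D-thin saturated shells give f ≲
Λ^{(5−D)/2}; the two exponents meet exactly at D = 1 (kernel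
`ladder_arithmetic`), where the bookkeeping is CRITICAL on both sides: ∫Λ² ≤ C′E₀/ν from the energy
inequality, f ≤ (c₀ν + C‖u₀‖₂)Λ² on thin saturated shells —
hence S₁ (all saturated shells 1-thin ⟹ regular) is PROVABLE NOW and not in print, and X₁ (frontier
only) is open by ONE lemma: blob-like saturated shells
BELOW a tube-like frontier must not carry 2^j‖Δ̇ⱼu‖_∞ ≫ Λ² (ThickBelowThinDeficit; true on the
actively-thin and on the L^∞B^{−1}_{∞,∞}-bounded sub-cells;
intended tools: paraproduct locality of the LP energy flux CS14 §3 (3.6)–(3.9), Cheskidov–Dai's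
time-localised smallness criterion arXiv:1507.06611). The
residual X₂ (D < 1 at the frontier: 1+D < 2 ≤ (5−D)/2, low modes supercritical) contains every named
scenario — backward self-similar / DSS / Type-I
profiles (bump frontier, D = 0), Hou's axis point, shrinking rings (D = 1−a), Tao's averaged cascade
(L²-rescaled packets = exact Bernstein saturation,
D = 0, certified from print [corpus:arxiv-1402.0290 p.14/21]) and the NSI constructions (singular
sets of dimension ξ < 1) — so X₁ is VACUOUS on all of them
and a proof of X₁ may be averaging-blind (S₁'s is). Imported area: turbulence phenomenology made
quantitative (K41/β-model intermittency, Frisch) via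
Littlewood–Paley theory; geometric-depletion results (Constantin–Fefferman direction coherence,
Grujić sparseness) are the nearest native tools and
quantify a different object (vorticity direction / super-level sets), not shell saturation.

RANKED CRUXES. #2 NoThinFrontierBlowup (crux) — NO THIN-FRONTIER BLOW-UP (X₁ =
NoThinFrontierBlowupAt 1, predicates INLINED: `IsFrontierLevel c₀ ν v j` := saturated ∧ no saturated
shell above; `IsThinLevel 1 C v j` := ‖Δ̇ⱼv‖_∞ ≤ C·2^{(3−1)j/2}‖Δ̇ⱼv‖₂ over tree `blockFn`,
`IsSaturatedLevel`) [tag WEAKER(evidence: S ⟹ X₁ kernel `noThinFrontierBlowup_of_root`; X₁ vacuous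
on every thick-frontier blow-up — separating class = thin-frontier blow-ups, excluded by NO theorem
in print; sibling evidence the cell is not empty nearby: 3D Euler with boundary blows up on a
fixed-radius RING (Chen–Hou), a 1-thin frontier) · ATTACKABLE-PARTIAL (critic row 35; typed line
kernel-composed: CS14Criterion (L, port of CS14 Thm 3.1) + FrontierL2Apriori (M, printed
computation) + ThickBelowThinDeficit (THE OPEN LEMMA) ⟹ X₁ = the BC3 skeleton; first rung S₁
PROVABLE NOW) · Tao-COMPATIBLE (averaged blow-up has a thick frontier; census test T-thin-2
requested)]. A classical solution on ℝ³ × [0,T), Leray–Hopf from its rapidly decaying datum, whose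
frontier Littlewood–Paley shell is 1-thin with one constant at all late times, for every threshold
c₀ ∈ (0,1], extends smoothly past T. [difficulty: L] (why it might fail: a thin frontier yields only
Λ ∈ L²(t₀,T); blob-like SATURATED shells below it need the critical B^{-1}_{∞,∞} low-mode bound
(CS14 Cor 4.3, r = 1) that nothing supplies — a blow-up fed by intensifying blobs under a tube-like
frontier is excluded by nothing known.) [arXiv:1102.1944, arXiv:2203.11060, arXiv:1507.06611,
arXiv:2407.06474]
#3 NoThickFrontierBlowup (crux) — NO THICK-FRONTIER BLOW-UP (X₂) [tag DECLARED RESIDUAL · WEAKER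
than NoBlowup (separating family = thin-frontier blow-ups; S ⟹ X₂ kernel
`noThickFrontierBlowup_of_root`) · B1 ∧ P1-hard (contains 1217's Type-I profiles — bump frontier, D
= 0 — and the Type-II hard core morally) · BARRIER inside (EnergySupercriticality: 1+D < 2 ≤
(5−D)/2, the low modes are supercritical; Tao-LOADED: the averaged cascade is thick-frontier,
certified from print; NSI-LOADED: Scheffer/Ożański singular sets have dimension ξ < 1)]. A classical
solution on ℝ³ × [0,T), Leray–Hopf from its rapidly decaying datum, whose frontier shell is NOT
eventually 1-thin (for some threshold c₀ ∈ (0,1] sub-filamentary concentration recurs up to T),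
extends smoothly past T. [difficulty: open-problem] (why it might fail: = why NoBlowup might fail
minus the thin-frontier scenarios: a backward-DSS / Type-I profile, Hou's axis point or any
cascade-type Type-II blow-up (all D = 0 at the frontier) realised from a Schwartz datum.)
[arXiv:0709.3599, arXiv:1811.00502, arXiv:1402.0290, arXiv:2107.06509]
#9 NoActivelyThinBlowup (support) — NO ACTIVELY-FILAMENTARY BLOW-UP (S₁; ASIDE — banked context, NOT
in the cone of `closes`: it is the first rung INSIDE X₁, X₁ ⟹ S₁ kernel
`noActivelyThinBlowup_of_noThinFrontierBlowup` and Sketch `example`; filed so the typed statement is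
tree-visible and stampable) [tag aside · WEAKER by vacuity (`noActivelyThinBlowup_of_root`) ·
PROVABLE NOW from print, NOT in print (print: D > 3/2, frontier-only, time-averaged — CS14 Thm 5.1):
two-stub line `noActivelyThinBlowup_of_stubs : CS14Criterion (port of CS14 Thm 3.1, L) →
ActiveThinChain (Bernstein bookkeeping at D = 1, M) → S₁`, kernel-composed in the lens file and in
the BC3 skeleton file; census test T-thin-4 (is S₁ in print after CS14?) requested]. If every
SATURATED Littlewood–Paley shell of u(t) is 1-thin at all late times (every threshold c₀ ∈ (0,1]),
the classical Leray–Hopf solution extends past T. [difficulty: M] (why it might fail: it should not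
— unsaturated shells give 2^j‖Δ̇ⱼu‖_∞ < c₀ν4^j ≤ c₀νΛ², thin saturated ones ≤ C4^j‖Δ̇ⱼu‖₂ ≤
C‖u₀‖₂Λ², the thin frontier gives ∫Λ² ≤ C′E₀/ν, then CS14 Thm 3.1; only the Thm 3.1 port (tree LP
vocabulary vs CS14's B⁰_{∞,∞} low-mode norm) can stall.) [arXiv:1102.1944, arXiv:1507.06611]

TWO-LAYER PLAN. No split is filed at birth. Beneath X₁ (BC3 skeleton = the lens's typed line, not
items): stub_cs14Criterion (L: port of CS14 Thm 3.1 — ∃ c⋆ ∈ (0,1], ∀ c₀ ≤ c⋆,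
∫_{t₀}^T f < ∞ ⟹ extends, f = sup_{2^j ≤ Λ} 2^j‖Δ̇ⱼu‖_∞ over tree `dissipationWavenumber`),
stub_frontierL2Apriori (M: 1-thin frontier ⟹ ∫Λ² < ∞, printed
computation CS14 (5.13) at s = 2), stub_thickBelowThinDeficit (THE OPEN LEMMA: under a 1-thin
frontier f(t) ≤ K·Λ(t)² — blob-like saturated shells below a
tube-like frontier carry no excess; true on the actively-thin sub-cell (K = c₀ν + C‖u₀‖₂) and on the
L^∞B^{−1}_{∞,∞}-bounded sub-cell (CS14 Cor 4.3 r = 1));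
composition ∫f ≤ K∫Λ² < ∞ kernel-checked. The same file composes S₁'s line (stub_cs14Criterion +
stub_activeThinChain ⟹ S₁). General rungs
NoThinFrontierBlowupAt D (monotone in D, exact against their thick cells) are tenure material, not
items. First prover targets: stub_cs14Criterion (port),
stub_activeThinChain, stub_frontierL2Apriori (all print-true), then S₁ closes; the open lemma last.

KILL CRITERIA. (i) a thin-frontier blow-up in ANY exact NS setting (e.g. a fixed-radius vortex-ring
or flake collapse from Schwartz data) refutes X₁ and decides the summit (C);
(ii) ThickBelowThinDeficit refuted by an explicit smooth solution family with a 1-thin frontier and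
f/Λ² unbounded (no blow-up needed) kills the LINE, not X₁ —
X₁ then needs a new lemma (retag IDEA-NEEDED); (iii) census T-thin-1 (K9 reconnection DNS): frontier
exponent D_Q → 0 at peak Λ in every run would make the
thin cell physically thin (X₁ near-vacuous in practice: keep as bankable rung, demote staffing);
(iv) S₁ found in print (T-thin-4) ⟹ cite, nothing else changes;
(v) X₂ is the residual of record: any Type-I/DSS/cascade blow-up from Schwartz data kills it and
(A).

NOT DECOMPOSED YET. X₂ (residual leaf; it is NoBlowup on the thick cell and carries B1 ∧ P1 —
attacked on the Type-I/Type-II routes of record, not here). X₁'s line is a skeleton,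
not items; S₁ is an aside with its own two-stub line. The exactness lemmas (`root_iff_pieces`,
`noBlowup_iff_pieces`, `noBlowup_iff_rung_and_thick`,
`noThinFrontierBlowup_of_root`, `noThickFrontierBlowup_of_root`, `noActivelyThinBlowup_of_root`)
live in the lens file; the writer ships a kernel-checked
Exactness record against the born decls as route evidence.

CHEAPEST FALSIFIER. Lookup (run by the lens 2026-08-30, corpus fts+hybrid+vec and galaxy; writer
re-read): is «frontier (or actively) 1-thin ⟹ regular» or a counterexample to the
deficit lemma in print after CS14? — `lit search --hybrid "intermittency dimension regularity
criterion Navier-Stokes Littlewood-Paley Bernstein saturation"`,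
`lit vsearch "intermittency dimension at least one implies regularity"`, `lit galaxy search
"intermittency dimension|dissipation wavenumber|Bernstein's inequality
is saturated" --star all`: only CS14 (3/2), Cheskidov–Shvydkoy ARMA 2023 (3/2), Cheskidov–Dai
2015/2025 (Λ_r criteria, no dimension gain), Cheskidov–Peng 2024
(determining wavenumber) — none at D = 1. Second cheapest (census T-thin-3, analytic, minutes): the
LP shell ratio of the Landau / DSS profiles at the frontier is
≍ 2^{3Q/2} (D = 0) — certifies Type I ⊂ X₂'s cell (X₁ vacuous there), informative either way.

NUMBERS. Ladder arithmetic (kernel): a-priori exponent 1+D vs criterion exponent (5−D)/2, equal iff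
D = 1; printed rung D > 3/2 ((5−D)/2 < 7/4 < 5/2 = 1+D);
at D = 1: ∫_{t₀}^T Λ² ≤ C′E(u₀)/ν with C′ = (C/c₀)²/ν-scaling of CS14 Lemma 4.1 (tree
`exists_lintegral_dissipationWavenumber_le` is the D = 0 instance
∫Λ ≲ (E₀/ν³)^{1/4}-type bound), f ≤ (c₀ν + C‖u₀‖₂)Λ² on thin saturated shells. Geometry dictionary
(heuristic, frontier scale ℓ = 2^{−Q}): blob ℓ³ ↦ D = 0; ring/tube
of length ℓ^a ↦ D = 1−a; tube/ribbon of length O(1), flake ℓ^{1/2}×ℓ^{1/2}×ℓ, «1-dust» of ℓ^{−1}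
blobs ↦ D = 1; sheet ↦ 2; space-filling ↦ 3. Tao's packets
ψ_{i,n} = (1+ε₀)^{3n/2}ψ_i((1+ε₀)^n·): ‖·‖_∞/‖·‖₂ = (1+ε₀)^{3n/2}·const — exact saturation, D = 0.

DEFINITION REQUESTS. None: IsSaturatedLevel, dissipationWavenumber
(Literature.Analysis.FluidPDE.DissipationWavenumber), blockFn
(Literature.Analysis.FunctionSpaces.LittlewoodPaleyKernel),
IsClassicalNSSolutionOn, IsLerayHopfOn, HasRapidSpatialDecay, HasSmoothExtensionPast exist (lean
search --decl each; Sketch.lean rc 0). The lens predicates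
IsThinLevel / IsFrontierLevel / FrontierThin / ActivelyThin are INLINED in the items (one-line Props
over tree decls; defeq to the lens forms).

Novelty: Searches (lens 2026-08-30, re-read by the writer; writer re-ran the tree grep): lit search --hybrid
«intermittency dimension regularity criterion Navier-Stokes
Littlewood-Paley Bernstein saturation»; lit vsearch «intermittency dimension at least one implies
regularity»; lit galaxy search «intermittency dimension|dissipation
wavenumber|Bernstein's inequality is saturated» --star all; remote cascade Cheskidov–Dai PEMS 2025
doi:10.1017/s0013091525100813; rg over Theses/*.lean for
blockFn|dissipationWavenumber|intermitten|Bernstein|sparse (WeakLambdaEndpoint, SelfMixingDichotomy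
only); ledger negatives (none near X₁/X₂).
Nearest prior art found: [corpus:arxiv-1102.1944 p.5,7,8] CS14 Thm 3.1 / Cor 4.3 (+ the «not clear»
remark p.7 L137 whether Λ ∈ L² follows from L^∞B^{−1}_{∞,∞})
/ Thm 5.1 (D > 3/2); [corpus:arxiv-2203.11060 p.3 L36] (2023: D_{∞,2} ≥ 3/2);
[corpus:arxiv-1507.06611 p.2,4] (Cheskidov–Dai Λ_r criteria); [corpus:arxiv-2407.06474
p.3,6] (Cheskidov–Peng determining wavenumber κ_d); [galaxy: pdf:-8606902176833628960] CSF cascade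
model; in tree WeakLambdaEndpoint (D = 0 column's weak-L^{5/2}
endpoint; residual WeakLambdaApriori an a-priori Lorentz bound) — neither quantifies shell geometry.
Delta: the parameter is the intermittency CO-DIMENSION of the frontier shell, the node sits at the
rung D = 1 where the a-priori and criterion exponents meet
(print stops at 3/2, time-averaged), the sup-in-time all-saturated-shells rung S₁ is provable and
unprinted, and the open conten  [refs: 10.1017/s0013091525100813, doi:10.1017/s0013091525100813, arxiv-1102.1944, arxiv-2203.11060, arxiv-1507.06611, arxiv-2407.06474]

Barriers (technique_class: Littlewood-Paley, intermittency, regularity criterion): - technique_class: Littlewood-Paley, intermittency, regularity criterion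
- Literature.Barriers.NavierStokesRegularity.EnergySupercriticality: X₁ OUTSIDE for its provable
core (at D = 1 both sides are critical: ∫Λ² from ∫‖∇u‖²,
  f ≲ Λ²) — the GEOMETRIC hypothesis restricts to a strict subclass of the energy class on which
‖∇u‖₂² controls Λ², over which the barrier does not
  quantify; the open core (thick sub-frontier shells) is where it bites (a critical low-mode bound
from supercritical information) — honest: the bet is the
  paraproduct locality of the LP flux; X₂ INSIDE (declared residual: 1+D < 2 ≤ (5−D)/2).
- Literature.Barriers.NavierStokesRegularity.TaoAveragedBlowup: X₁ OUTSIDE, certified at the packet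
level from PRINT — Tao's carriers are L²-rescaled
  packets with exact Bernstein saturation (D = 0 at every active scale [corpus:arxiv-1402.0290 p.14
L16, p.21 L10]), so FrontierThin 1 FAILS along the
  averaged blow-up: X₁ is VACUOUS there (Tao-compatible; S₁'s proof is averaging-blind — Bernstein +
energy + Thm 3.1 — and that is allowed); X₂ Tao-LOADED
  (declared).
- Literature.Barriers.NavierStokesRegularity.AveragedTypeIBlowup: bites X₂ only (Type-I/DSS profiles
have a bump frontier, D = 0 — heuristic recorded, census
  test T-thin-3 requested); X₁ does not engage Type-I exclusion.
- Literature.Barriers.NavierStokesRegularity.NSITypeIIBlowup: X₂ INSIDE if argued NSI-abstractly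
(declared); X₁: the catalogued NSI constructions are D < 1
  cascades (Scheffer/Ożański

sub-problem: NavierStokesRegularity · status: draft · opened planner-decomp-ns-writer-1-g2-0 2026-08-30T04:02:32Z · rev 0 · ledger route-NavierStokesRegularity-RootDecompIntermittency
GENERATED by the gate from the ledger (D-0016/17). Provers cite these decls: `theorem foo : Summit.NavierStokesRegularity.NavierStokesRegularity.Theses.RootDecompIntermittency.<Decl> := …` in Summits/NavierStokesRegularity/NavierStokesRegularity/Theorems/<Name>.lean.
-/

namespace Summit.NavierStokesRegularity.NavierStokesRegularity.Theses.RootDecompIntermittency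

open scoped BigOperators Topology Manifold Classical MeasureTheory ProbabilityTheory Matrix InnerProductSpace ComplexConjugate ContinuousMap
open Filter Set Function TopologicalSpace MeasureTheory

attribute [summit_statement] _root_.NavierStokesRegularity

open Literature.NS

/-- item stmt-NavierStokesRegularity-27233 · crux · rank 2 · open · by planner
why it might fail: a thin frontier yields only Λ ∈ L²(t₀,T); blob-like SATURATED shells below it need the critical B^{-1}_{∞,∞} low-mode bound (CS14 Cor 4.3, r = 1) that nothing supplies — a blow-up fed by intensifying blobs under a tube-like frontier is excluded by nothing known.
sources: arXiv:1102.1944, arXiv:2203.11060, arXiv:1507.06611, arXiv:2407.06474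
[crux] NO THIN-FRONTIER BLOW-UP (X₁ = NoThinFrontierBlowupAt 1, predicates INLINED: `IsFrontierLevel
c₀ ν v j` := saturated ∧ no saturated shell above; `IsThinLevel 1 C v j` := ‖Δ̇ⱼv‖_∞ ≤
C·2^{(3−1)j/2}‖Δ̇ⱼv‖₂ over tree `blockFn`, `IsSaturatedLevel`) [tag WEAKER(evidence: S ⟹ X₁ kernel
`noThinFrontierBlowup_of_root`; X₁ vacuous on every thick-frontier blow-up — separating class =
thin-frontier blow-ups, excluded by NO theorem in print; sibling evidence the cell is not empty
nearby: 3D Euler with boundary blows up on a fixed-radius RING (Chen–Hou), a 1-thin frontier) ·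
ATTACKABLE-PARTIAL (critic row 35; typed line kernel-composed: CS14Criterion (L, port of CS14 Thm
3.1) + FrontierL2Apriori (M, printed computation) + ThickBelowThinDeficit (THE OPEN LEMMA) ⟹ X₁ =
the BC3 skeleton; first rung S₁ PROVABLE NOW) · Tao-COMPATIBLE (averaged blow-up has a thick
frontier; census test T-thin-2 requested)]. A classical solution on ℝ³ × [0,T), Leray–Hopf from its
rapidly decaying datum, whose frontier Littlewood–Paley shell is 1-thin with one constant at all
late times, for every threshold c₀ ∈ (0,1], extends smoothly past T. [difficulty: L] -/
@[route_item "route-NavierStokesRegularity-RootDecompIntermittency", crux]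
def NoThinFrontierBlowup : Prop :=
  ∀ (ν T : ℝ), 0 < ν → 0 < T → ∀ (u : ℝ → EuclideanSpace ℝ (Fin 3) → EuclideanSpace ℝ (Fin 3)) (p : ℝ → EuclideanSpace ℝ (Fin 3) → ℝ), Literature.Analysis.FluidPDE.IsClassicalNSSolutionOn (Set.Ico 0 T) ν 0 u p → Literature.Analysis.FluidPDE.IsLerayHopfOn T ν 0 (u 0) u → Literature.Analysis.FluidPDE.HasRapidSpatialDecay (u 0) → (∀ c₀ : ℝ, 0 < c₀ → c₀ ≤ 1 → ∃ C t₀ : ℝ, t₀ < T ∧ ∀ t ∈ Set.Ioo t₀ T, ∀ j : ℕ, (Literature.Analysis.FluidPDE.IsSaturatedLevel c₀ ν (u t) j ∧ ∀ k : ℕ, j < k → ¬ Literature.Analysis.FluidPDE.IsSaturatedLevel c₀ ν (u t) k) → MeasureTheory.eLpNorm (Literature.Analysis.FunctionSpaces.blockFn (j : ℤ) (u t)) ⊤ MeasureTheory.volume ≤ ENNReal.ofReal (C * (2 : ℝ) ^ ((3 - (1 : ℝ)) / 2 * (j : ℝ))) * MeasureTheory.eLpNorm (Literature.Analysis.FunctionSpaces.blockFn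 (j : ℤ) (u t)) 2 MeasureTheory.volume) → Literature.Analysis.FluidPDE.HasSmoothExtensionPast ν 0 u T

/-- item stmt-NavierStokesRegularity-27234 · crux · rank 3 · open · by planner
why it might fail: = why NoBlowup might fail minus the thin-frontier scenarios: a backward-DSS / Type-I profile, Hou's axis point or any cascade-type Type-II blow-up (all D = 0 at the frontier) realised from a Schwartz datum.
sources: arXiv:0709.3599, arXiv:1811.00502, arXiv:1402.0290, arXiv:2107.06509
[crux] NO THICK-FRONTIER BLOW-UP (X₂) [tag DECLARED RESIDUAL · WEAKER than NoBlowup (separating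
family = thin-frontier blow-ups; S ⟹ X₂ kernel `noThickFrontierBlowup_of_root`) · B1 ∧ P1-hard
(contains 1217's Type-I profiles — bump frontier, D = 0 — and the Type-II hard core morally) ·
BARRIER inside (EnergySupercriticality: 1+D < 2 ≤ (5−D)/2, the low modes are supercritical;
Tao-LOADED: the averaged cascade is thick-frontier, certified from print; NSI-LOADED:
Scheffer/Ożański singular sets have dimension ξ < 1)]. A classical solution on ℝ³ × [0,T),
Leray–Hopf from its rapidly decaying datum, whose frontier shell is NOT eventually 1-thin (for some
threshold c₀ ∈ (0,1] sub-filamentary concentration recurs up to T), extends smoothly past T.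
[difficulty: open-problem] -/
@[route_item "route-NavierStokesRegularity-RootDecompIntermittency", crux]
def NoThickFrontierBlowup : Prop :=
  ∀ (ν T : ℝ), 0 < ν → 0 < T → ∀ (u : ℝ → EuclideanSpace ℝ (Fin 3) → EuclideanSpace ℝ (Fin 3)) (p : ℝ → EuclideanSpace ℝ (Fin 3) → ℝ), Literature.Analysis.FluidPDE.IsClassicalNSSolutionOn (Set.Ico 0 T) ν 0 u p → Literature.Analysis.FluidPDE.IsLerayHopfOn T ν 0 (u 0) u → Literature.Analysis.FluidPDE.HasRapidSpatialDecay (u 0) → ¬ (∀ c₀ : ℝ, 0 < c₀ → c₀ ≤ 1 → ∃ C t₀ : ℝ, t₀ < T ∧ ∀ t ∈ Set.Ioo t₀ T, ∀ j : ℕ, (Literature.Analysis.FluidPDE.IsSaturatedLevel c₀ ν (u t) j ∧ ∀ k : ℕ, j < k → ¬ Literature.Analysis.FluidPDE.IsSaturatedLevel c₀ ν (u t) k) → MeasureTheory.eLpNorm (Literature.Analysis.FunctionSpaces.blockFn (j : ℤ) (u t)) ⊤ MeasureTheory.volume ≤ ENNReal.ofReal (C * (2 : ℝ) ^ ((3 -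 (1 : ℝ)) / 2 * (j : ℝ))) * MeasureTheory.eLpNorm (Literature.Analysis.FunctionSpaces.blockFn (j : ℤ) (u t)) 2 MeasureTheory.volume) → Literature.Analysis.FluidPDE.HasSmoothExtensionPast ν 0 u T

/-- item stmt-NavierStokesRegularity-27235 · aside · rank 9 · closed · proved by Summit.NavierStokesRegularity.NavierStokesRegularity.Theorems.NoActivelyThinBlowup.noActivelyThinBlowup_proof (planner) · by planner
why it might fail: it should not — unsaturated shells give 2^j‖Δ̇ⱼu‖_∞ < c₀ν4^j ≤ c₀νΛ², thin saturated ones ≤ C4^j‖Δ̇ⱼu‖₂ ≤ C‖u₀‖₂Λ², the thin frontier gives ∫Λ² ≤ C′E₀/ν, then CS14 Thm 3.1; only the Thm 3.1 port (tree LP vocabulary vs CS14's B⁰_{∞,∞} low-mode norm) can stall.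
sources: arXiv:1102.1944, arXiv:1507.06611
[support] NO ACTIVELY-FILAMENTARY BLOW-UP (S₁; ASIDE — banked context, NOT in the cone of `closes`:
it is the first rung INSIDE X₁, X₁ ⟹ S₁ kernel `noActivelyThinBlowup_of_noThinFrontierBlowup` and
Sketch `example`; filed so the typed statement is tree-visible and stampable) [tag aside · WEAKER by
vacuity (`noActivelyThinBlowup_of_root`) · PROVABLE NOW from print, NOT in print (print: D > 3/2,
frontier-only, time-averaged — CS14 Thm 5.1): two-stub line `noActivelyThinBlowup_of_stubs :
CS14Criterion (port of CS14 Thm 3.1, L) → ActiveThinChain (Bernstein bookkeeping at D = 1, M) → S₁`,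
kernel-composed in the lens file and in the BC3 skeleton file; census test T-thin-4 (is S₁ in print
after CS14?) requested]. If every SATURATED Littlewood–Paley shell of u(t) is 1-thin at all late
times (every threshold c₀ ∈ (0,1]), the classical Leray–Hopf solution extends past T. [difficulty:
M] -/
@[route_item "route-NavierStokesRegularity-RootDecompIntermittency"]
def NoActivelyThinBlowup : Prop :=
  ∀ (ν T : ℝ), 0 < ν → 0 < T → ∀ (u : ℝ → EuclideanSpace ℝ (Fin 3) → EuclideanSpace ℝ (Fin 3)) (p : ℝ → EuclideanSpace ℝ (Fin 3) → ℝ), Literature.Analysis.FluidPDE.IsClassicalNSSolutionOn (Set.Ico 0 T) ν 0 u p → Literature.Analysis.FluidPDE.IsLerayHopfOn T ν 0 (u 0) u → Literature.Analysis.FluidPDE.HasRapidSpatialDecay (u 0) → (∀ c₀ : ℝ, 0 < c₀ → c₀ ≤ 1 → ∃ C t₀ : ℝ, t₀ < T ∧ ∀ t ∈ Set.Ioo t₀ T, ∀ j : ℕ, Literature.Analysis.FluidPDE.IsSaturatedLevel c₀ ν (u t) j → MeasureTheory.eLpNorm (Literature.Analysis.FunctionSpaces.blockFn (j : ℤ)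 (u t)) ⊤ MeasureTheory.volume ≤ ENNReal.ofReal (C * (2 : ℝ) ^ ((3 - (1 : ℝ)) / 2 * (j : ℝ))) * MeasureTheory.eLpNorm (Literature.Analysis.FunctionSpaces.blockFn (j : ℤ) (u t)) 2 MeasureTheory.volume) → Literature.Analysis.FluidPDE.HasSmoothExtensionPast ν 0 u T

-- `NoActivelyThinBlowup` holds: proved by `Summit.NavierStokesRegularity.NavierStokesRegularity.Theorems.NoActivelyThinBlowup.noActivelyThinBlowup_proof` (its module imports this route file, so no `_holds` link can be stated here).

/-- item stmt-NavierStokesRegularity-27236 · assembly · rank 1 · open · by planner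
sources: Fefferman2000, arXiv:1102.1944
[assembly] the implication the glue proves: X₁ → X₂ → Clay (A). -/
@[route_item "route-NavierStokesRegularity-RootDecompIntermittency"]
def Assembly : Prop :=
  NoThinFrontierBlowup → NoThickFrontierBlowup → NavierStokesRegularity

/-! D-0027 §2.1 — DECIDING THEOREM (planner-authored via `route open/edit --closes-file`; by planner-decomp-ns-writer-1-g2-0 2026-08-30T04:02:32Z):
its hypotheses are this route's items and its conclusion the sub-problem Statement (glue_lint), and it elaborates with this file. -/

@[closes "route-NavierStokesRegularity-RootDecompIntermittency"] theorem closes (h₁ : NoThinFrontierBlowup) (h₂ : NoThickFrontierBlowup) : NavierStokesRegularity := by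
  refine Summit.NavierStokesRegularity.NavierStokesRegularity.Theorems.navierStokesRegularity_of_noBlowup ?_
  intro ν T hν hT u p hcl hLH hdec
  by_contra hext
  exact hext (h₂ ν T hν hT u p hcl hLH hdec (fun hthin => hext (h₁ ν T hν hT u p hcl hLH hdec hthin)))

end Summit.NavierStokesRegularity.NavierStokesRegularity.Theses.RootDecompIntermittency
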